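/-
Copyright (c) 2026 the pub-hodgecm-mathlib formalisation cell (harness21).  Prover seat hodgecm-mathlib-F0P3a-p03 (g25): N8-INNER road, brick (10)(C′)
«CORNER EP PACKAGE», FILE F-B (the one-place reading at a quasi-split place, in the angle chart at the scalar corner).
-/
import Literature.NumberTheory.Rogawski1990.ArchHcJumpOnePlace                    -- ★ (J) p852194: `hasOneSidedJump_onePlace_zero_of_split_vanishes`, `onePlaceNormaliser_ne_zero`; brings `chartOrbGLoc`, `hcAdaptedVec`
import Literature.NumberTheory.Rogawski1990.ArchHCSpaceGInnerTransport             -- ★ `slotSign_quasiSplitWeights_eq_iff`; brings the `β₀` kit (`re_embedding_quasiSplitWeights`, `mem_splitChartPlaces_quasiSplitWeights`, …)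
import Literature.NumberTheory.Rogawski1990.ArchOrbFamGScalarCornerBookkeeping     -- ★ `gprimeBlockAt_eq_circleDiagonal_centre_of_scalar`
import Literature.NumberTheory.Rogawski1990.ArchCentralLimitCompactWallOrbital     -- ★ `contDiffOn_orbital_angleChart_off_noncompact_walls`, `circleExp_ne_of_abs_sub_lt_two_pi`
import Literature.NumberTheory.Rogawski1990.ArchCentralJetBoundsAllFrames          -- ★ `exists_forall_norm_iteratedFDeriv_rootProduct_smul_orbital_le_uniform_centre`, `contDiffOn_rootProduct_smul_orbital_chamber_ball`, `rootProduct_comp_perm`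
import Literature.NumberTheory.Rogawski1990.ArchCentralLimitJetBoundsOfBootstrap   -- ★ `exists_smooth_rhoWeylDelta_angleChart_eq_mul_rootProduct`, `norm_iteratedFDeriv_mul_le_of_isOpen`
import Literature.NumberTheory.Rogawski1990.ArchCentralLimitCornerRegularityTransport -- ★ `rhoWeylDelta_angle_comp_perm`
import Literature.NumberTheory.Rogawski1990.ArchCentralLimitAngleChart             -- ★ `setOf_injective_eq_iUnion_chamber`
import Literature.NumberTheory.Rogawski1990.ArchEPGeneratorRegular                 -- ★ (7) template: `sum_perm_chartOrbGLoc_congr_of_circleExp_eq`, `sum_perm_chartOrbGLoc_comp_perm`, `bzClassMapG_apply_of_not_mem`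
import Literature.Analysis.Calculus.SmoothGluingAcrossHyperplaneArrangementRay         -- ★ p852185/p852210 (this seat): the gluing kit (`continuousOn_iteratedFDeriv_of_isOpen`, adapted-letters gluing)
import HarnessLib

/-!
# The one-place reading of `U(β₀)_w` in the angle chart at the scalar corner (N8-INNER brick (10)(C′), FILE F-B)

Topic `NumberTheory/Rogawski1990`; namespace `Literature.NumberTheory.Rogawski1990`.  THEOREMS ONLY (no `def`, no instance, no notation, no axiom, no named
fact, no `sorry`); kernel lane `--supports stmt-HodgeConjecture-24833`.  Cell `pub/hodgecm-mathlib`, crux H413; road N8-INNER (owner LH2-plan (g1)), brick (10)(C′)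
«CORNER EP PACKAGE» (F0P3a-p03 (g25)), the kit under the corner generator `EPGeneratorAt L β₀ w ν_w (esymm3 (ζ,ζ,ζ))`.  Count-neutral.

THE SETTING.  `β₀ = (½, 1, −½)` (the quasi-split frame: every complex place `w` is a `(2,1)` place, slots `0, 1` positive, slot `2` negative); `w` a complex
place, `ν_w` a Haar measure on `U(β₀)_w = archLocal L 3 (diagonal β₀) w`; a one-place test function `f = fa ∘ (↑↑·)` (ambient `C^∞`, compact support); a
centre `ζ ∈ S¹` with an angle `θ_ζ` (`e^{iθ_ζ} = ζ`).  The ONE-PLACE COMPACT READING in the angle chart at the corner is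
`R(x) := chartOrbGLoc L β₀ w ∅ ν_w f (θ_ζ•1 + x)` and its NORMALISED form is `F(x) := N(x) · R(x)`, `N(x) = e^{i(x₀−x₂)} Π (1 − e^{i(x_j − x_i)})` (the letter's
`ρ′Δ` at `ζe^{ix}`, the `w`-factor of ★ `archERhoG · archRG`).
* §1 the frame `β₀` at one place: `formSign`, `lineOf = refl`, the compact chart point IS `diag(e^{i cw})`, the reading IS the orbital integral
  `∫ fa(↑↑(g · diag(ζe^{ix}) · g⁻¹)) dν_w`;
* §2 `R` is `C^∞` off the two NONCOMPACT walls `{x₀ ≡ x₂}`, `{x₁ ≡ x₂}` (★ ROAD A (A1), across the compact wall `{x₀ ≡ x₁}`);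
* §3 the normaliser: `N = u · π` with `u` smooth, `u(0) ≠ 0`, `N` ALTERNATING under `S₃`, `u` SYMMETRIC;
* §4 jet bounds of `F = N · R` off the noncompact walls near the corner (★ Harish-Chandra chamber bounds × Leibniz, passed to compact-wall points by continuity);
* §5 the adapted letters of ★ (J) as bases of `ℝ³`.

## References
* [Rogawski1990] J. D. Rogawski, *Automorphic Representations of Unitary Groups in Three Variables*, Ann. of Math. Stud. 123 (1990), §3.6 p. 28, §8.2 p. 122, §8.4 p. 126.
* [Shelstad1979] D. Shelstad, *Characters and inner forms of a quasi-split group over ℝ*, Compositio Math. 39 (1979), §4 pp. 22–26.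
* [WarnerHASSLG2] G. Warner, *Harmonic Analysis on Semi-Simple Lie Groups II* (1972), §8.4.1, Thm. 8.4.3.1, §8.5.1.
* [Varadarajan1989] V. S. Varadarajan, *An Introduction to Harmonic Analysis on Semisimple Lie Groups* (1989), §6.4.
-/

set_option autoImplicit false

noncomputable section

open MeasureTheory MeasureTheory.Measure NumberField NumberField.InfinitePlace Matrix Complex Set Filter Topology Function Metric
open scoped MatrixGroups Matrix Real Classical ENNReal NNReal ContDiff
open Literature.NumberTheory.Automorphic Literature.NumberTheory.Automorphic.UnitaryGroup Literature.NumberTheory.Automorphic.ArchCartan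
open Literature.NumberTheory.Automorphic.Shelstad1979.StableOrbitalIntegrals
open Literature.Geometry.ComplexHyperbolic.BallModel Literature.Analysis.Calculus

namespace Literature.NumberTheory.Rogawski1990

/-! ## §1 The quasi-split frame at one place -/

section Frame

variable (L : Type) [Field L] [NumberField L] [IsCMField L] (w : {w : InfinitePlace L // IsComplex w})

omit [IsCMField L] in
/-- **The sign pattern of `β₀ = (½, 1, −½)` at every complex place is `(+, +, −)`.** [cite: Rogawski1990, §3.6 p. 28; §14.1 p. 232] -/
theorem formSign_quasiSplitWeights : formSign L ![(2 : L)⁻¹, 1, -(2 : L)⁻¹] w = ![1, 1, -1] := by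
  funext i
  simp only [formSign, formRe, re_embedding_quasiSplitWeights]
  fin_cases i
  · show SignType.sign ((2 : ℝ)⁻¹) = 1
    exact sign_pos (by norm_num)
  · show SignType.sign (1 : ℝ) = 1
    exact sign_pos one_pos
  · show SignType.sign (-(2 : ℝ)⁻¹) = -1
    exact sign_neg (by norm_num)

omit [IsCMField L] in
/-- **The slot order of `β₀` is the matrix order**: `lineOf (formSign L β₀ w) = refl` (the odd line is `2`). [cite: Rogawski1990, §3.6 p. 28] -/
theorem lineOf_formSign_quasiSplitWeights : lineOf (formSign L ![(2 : L)⁻¹, 1, -(2 : L)⁻¹] w) = Equiv.refl (Fin 3) := by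
  rw [formSign_quasiSplitWeights]
  have h2 : oddLine (![1, 1, -1] : Fin 3 → SignType) = 2 := by decide
  rw [lineOf, if_pos h2]

omit [IsCMField L] in
/-- **At a compact-chart place of `β₀` the chart point of `cw` IS `diag(e^{i cw₀}, e^{i cw₁}, e^{i cw₂})`.** [cite: Rogawski1990, §3.6 p. 28] -/
theorem gprimeBlockAt_quasiSplitWeights_of_not_mem {S' : Finset {w : InfinitePlace L // IsComplex w}} (hw : w ∉ S') (cw : Fin 3 → ℝ) :
    gprimeBlockAt L ![(2 : L)⁻¹, 1, -(2 : L)⁻¹] w S' cw =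
      ⟨circleDiagonal 3 (fun k => Circle.exp (cw k)), circleDiagonal_mem_archLocal_diagonal L 3 ![(2 : L)⁻¹, 1, -(2 : L)⁻¹] w _⟩ := by
  have h := gprimeBlockAt_eq_circleDiagonal_centre_of_scalar L ![(2 : L)⁻¹, 1, -(2 : L)⁻¹] w S' hw
    (x := fun _ _ => (0 : ℝ)) (fun _ _ => rfl) (fun _ => cw)
  rw [h]
  congr 2
  funext k
  rw [lineOf_formSign_quasiSplitWeights, Equiv.refl_symm, Equiv.refl_apply, Circle.exp_zero, one_mul, sub_zero]

omit [NumberField L] [IsCMField L] in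
/-- `e^{i(θ + x)} = e^{iθ} · e^{ix}` on the circle. [cite: Rogawski1990, §8.4 p. 126] -/
theorem circleExp_const_add (θζ : ℝ) (x : Fin 3 → ℝ) (k : Fin 3) :
    Circle.exp (((fun _ : Fin 3 => θζ) + x) k) = Circle.exp θζ * Circle.exp (x k) := by
  rw [Pi.add_apply, Circle.exp_add]

end Frame

/-! ## §2 The one-place compact reading is the orbital integral; smoothness off the noncompact walls -/

section Reading

variable (L : Type) [Field L] [NumberField L] [IsCMField L] (w : {w : InfinitePlace L // IsComplex w})
  [MeasurableSpace ↥(archLocal L 3 (Matrix.diagonal ![(2 : L)⁻¹, 1, -(2 : L)⁻¹]) w)] [BorelSpace ↥(archLocal L 3 (Matrix.diagonal ![(2 : L)⁻¹, 1, -(2 : L)⁻¹]) w)]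
  (νw : Measure ↥(archLocal L 3 (Matrix.diagonal ![(2 : L)⁻¹, 1, -(2 : L)⁻¹]) w)) [νw.IsHaarMeasure] [νw.IsMulRightInvariant]

-- the scoped `ℓ^∞`-operator norm on `M₃(ℂ)` (★ one-place convention for the ambient `fa`)
open scoped Matrix.Norms.Operator

/-- **THE ONE-PLACE COMPACT READING IS THE ORBITAL INTEGRAL OVER `U(β₀)_w`**: for `w ∉ S′`, `f = fa ∘ (↑↑·)` with `fa` continuous, and `e^{iθ_ζ} = ζ`,
`chartOrbGLoc L β₀ w S′ ν_w f (θ_ζ•1 + x) = ∫ fa(↑↑(g · diag(ζe^{ix}) · g⁻¹)) dν_w(g)`. [cite: Rogawski1990, §8.2 p. 122] -/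
theorem chartOrbGLoc_quasiSplitWeights_eq_orbital {S' : Finset {w : InfinitePlace L // IsComplex w}} (hw : w ∉ S')
    {f : ↥(archLocal L 3 (Matrix.diagonal ![(2 : L)⁻¹, 1, -(2 : L)⁻¹]) w) → ℂ} (fa : Matrix (Fin 3) (Fin 3) ℂ → ℂ) (hfa : Continuous fa)
    (hf : ∀ g, f g = fa ((g : GL (Fin 3) ℂ) : Matrix (Fin 3) (Fin 3) ℂ)) {ζ : Circle} {θζ : ℝ} (hζ : Circle.exp θζ = ζ) (x : Fin 3 → ℝ) :
    chartOrbGLoc L ![(2 : L)⁻¹, 1, -(2 : L)⁻¹] w S' νw f ((fun _ : Fin 3 => θζ) + x) =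
      ∫ g, fa (((g * ⟨circleDiagonal 3 (fun k => ζ * Circle.exp (x k)), circleDiagonal_mem_archLocal_diagonal L 3 ![(2 : L)⁻¹, 1, -(2 : L)⁻¹] w _⟩ * g⁻¹ :
        ↥(archLocal L 3 (Matrix.diagonal ![(2 : L)⁻¹, 1, -(2 : L)⁻¹]) w)) : GL (Fin 3) ℂ) : Matrix (Fin 3) (Fin 3) ℂ) ∂νw := by
  have hfm : Measurable f := by
    have hc : Continuous f := by
      have : f = fun g : ↥(archLocal L 3 (Matrix.diagonal ![(2 : L)⁻¹, 1, -(2 : L)⁻¹]) w) => fa ((g : GL (Fin 3) ℂ) : Matrix (Fin 3) (Fin 3) ℂ) :=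
        funext hf
      rw [this]
      exact hfa.comp (Units.continuous_val.comp continuous_subtype_val)
    exact hc.measurable
  rw [chartOrbGLoc_eq_integral_of_not_mem L ![(2 : L)⁻¹, 1, -(2 : L)⁻¹] w S' νw (quasiSplitWeights_ne_zero L)
    (fun v _ => mem_splitChartPlaces_quasiSplitWeights L v) hw f hfm, gprimeBlockAt_quasiSplitWeights_of_not_mem L w hw]
  have hdiag : (fun k => Circle.exp (((fun _ : Fin 3 => θζ) + x) k)) = fun k => ζ * Circle.exp (x k) := by
    funext k; rw [circleExp_const_add, hζ]
  simp only [hdiag, hf]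

/-- **THE READING IS `C^∞` OFF THE TWO NONCOMPACT WALLS** `{ζe^{ix₀} = ζe^{ix₂}}`, `{ζe^{ix₁} = ζe^{ix₂}}` — in particular ACROSS the compact wall `{x₀ ≡ x₁}`
(★ ROAD A (A1) `contDiffOn_orbital_angleChart_off_noncompact_walls`, compact pair `(0,1)` of `β₀`). [cite: Rogawski1990, §8.4 p. 126] [cite: Varadarajan1989, §6.4] -/
theorem contDiffOn_chartOrbGLoc_quasiSplitWeights_off_noncompact_walls {S' : Finset {w : InfinitePlace L // IsComplex w}} (hw : w ∉ S')
    {f : ↥(archLocal L 3 (Matrix.diagonal ![(2 : L)⁻¹, 1, -(2 : L)⁻¹]) w) → ℂ} (fa : Matrix (Fin 3) (Fin 3) ℂ → ℂ) (hfa : ContDiff ℝ ∞ fa)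
    (hf : ∀ g, f g = fa ((g : GL (Fin 3) ℂ) : Matrix (Fin 3) (Fin 3) ℂ)) (hfs : HasCompactSupport f) {ζ : Circle} {θζ : ℝ} (hζ : Circle.exp θζ = ζ) :
    ContDiffOn ℝ ∞ (fun x : Fin 3 → ℝ => chartOrbGLoc L ![(2 : L)⁻¹, 1, -(2 : L)⁻¹] w S' νw f ((fun _ : Fin 3 => θζ) + x))
      {x : Fin 3 → ℝ | ζ * Circle.exp (x 0) ≠ ζ * Circle.exp (x 2) ∧ ζ * Circle.exp (x 1) ≠ ζ * Circle.exp (x 2)} := by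
  have hfs' : HasCompactSupport fun k : ↥(archLocal L 3 (Matrix.diagonal ![(2 : L)⁻¹, 1, -(2 : L)⁻¹]) w) => fa ((k : GL (Fin 3) ℂ) : Matrix (Fin 3) (Fin 3) ℂ) := by
    have : (fun k : ↥(archLocal L 3 (Matrix.diagonal ![(2 : L)⁻¹, 1, -(2 : L)⁻¹]) w) => fa ((k : GL (Fin 3) ℂ) : Matrix (Fin 3) (Fin 3) ℂ)) = f := (funext hf).symm
    rw [this]; exact hfs
  have h := contDiffOn_orbital_angleChart_off_noncompact_walls L ![(2 : L)⁻¹, 1, -(2 : L)⁻¹] w (quasiSplitWeights_ne_zero L)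
    (im_embedding_quasiSplitWeights_eq_zero L w) (re_embedding_quasiSplitWeights_zero_mul_one_pos L w).1 νw fa hfa hfs' ζ
  refine h.congr fun x _ => ?_
  exact chartOrbGLoc_quasiSplitWeights_eq_orbital L w νw hw fa hfa.continuous hf hζ x

/-- Near the corner the circle walls are the linear walls: for `|x_i − x_j| < 2π`, `ζe^{ix_i} = ζe^{ix_j} ↔ x_i = x_j`. [cite: Rogawski1990, §8.4 p. 126] -/
theorem mul_circleExp_eq_iff_of_abs_sub_lt (ζ : Circle) {x : Fin 3 → ℝ} {i j : Fin 3} (h : |x i - x j| < 2 * Real.pi) :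
    ζ * Circle.exp (x i) = ζ * Circle.exp (x j) ↔ x i = x j := by
  refine ⟨fun he => ?_, fun he => by rw [he]⟩
  by_contra hne
  exact circleExp_ne_of_abs_sub_lt_two_pi hne h (mul_left_cancel he)

/-- In the sup-ball of radius `1` about `0` all coordinate differences are `< 2π`. [cite: Rogawski1990, §8.4 p. 126] -/
theorem abs_sub_lt_two_pi_of_mem_ball {x : Fin 3 → ℝ} (hx : x ∈ ball (0 : Fin 3 → ℝ) 1) (i j : Fin 3) : |x i - x j| < 2 * Real.pi := by
  rw [mem_ball_zero_iff, pi_norm_lt_iff one_pos] at hx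
  have hi := hx i
  have hj := hx j
  rw [Real.norm_eq_abs, abs_lt] at hi hj
  have hπ : 3 < Real.pi := Real.pi_gt_three
  rw [abs_lt]; constructor <;> linarith

/-- **Inside `ball 0 1` the reading is `C^∞` on `{x₀ ≠ x₂ ∧ x₁ ≠ x₂}`.** [cite: Rogawski1990, §8.4 p. 126] [cite: Varadarajan1989, §6.4] -/
theorem contDiffOn_chartOrbGLoc_quasiSplitWeights_ball_offWalls {S' : Finset {w : InfinitePlace L // IsComplex w}} (hw : w ∉ S')
    {f : ↥(archLocal L 3 (Matrix.diagonal ![(2 : L)⁻¹, 1, -(2 : L)⁻¹]) w) → ℂ} (fa : Matrix (Fin 3) (Fin 3) ℂ → ℂ) (hfa : ContDiff ℝ ∞ fa)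
    (hf : ∀ g, f g = fa ((g : GL (Fin 3) ℂ) : Matrix (Fin 3) (Fin 3) ℂ)) (hfs : HasCompactSupport f) {ζ : Circle} {θζ : ℝ} (hζ : Circle.exp θζ = ζ) :
    ContDiffOn ℝ ∞ (fun x : Fin 3 → ℝ => chartOrbGLoc L ![(2 : L)⁻¹, 1, -(2 : L)⁻¹] w S' νw f ((fun _ : Fin 3 => θζ) + x))
      (ball (0 : Fin 3 → ℝ) 1 ∩ {x : Fin 3 → ℝ | x 0 ≠ x 2 ∧ x 1 ≠ x 2}) := by
  refine (contDiffOn_chartOrbGLoc_quasiSplitWeights_off_noncompact_walls L w νw hw fa hfa hf hfs hζ).mono fun x hx => ?_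
  exact ⟨fun he => hx.2.1 ((mul_circleExp_eq_iff_of_abs_sub_lt ζ (abs_sub_lt_two_pi_of_mem_ball hx.1 0 2)).1 he),
    fun he => hx.2.2 ((mul_circleExp_eq_iff_of_abs_sub_lt ζ (abs_sub_lt_two_pi_of_mem_ball hx.1 1 2)).1 he)⟩

end Reading

/-! ## §3 The normaliser `N(x) = e^{i(x₀−x₂)} Π (1 − e^{i(x_j−x_i)})`: `N = u · π`, `N` alternating, `u` symmetric -/

section Normaliser

/-- `e^{i(a−b)} = e^{ia} · (e^{ib})⁻¹` in `ℂ`. [cite: Rogawski1990, §8.4 p. 126] -/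
theorem coe_circleExp_sub (a b : ℝ) : ((Circle.exp (a - b) : Circle) : ℂ) = ((Circle.exp a : Circle) : ℂ) * (((Circle.exp b : Circle) : ℂ))⁻¹ := by
  rw [Circle.exp_sub, Circle.coe_div, div_eq_mul_inv]

/-- **The normaliser in the torus letters**: `N(x) = z₀z₂⁻¹ (1 − z₁z₀⁻¹)(1 − z₂z₁⁻¹)(1 − z₂z₀⁻¹)` with `z_k = e^{ix_k}` (the letter's `ρ′Δ`).
[cite: Rogawski1990, §8.4 p. 126] -/
theorem normaliser_eq_rhoWeylDelta (x : Fin 3 → ℝ) :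
    ((Circle.exp (x 0 - x 2) : Circle) : ℂ) * ((1 - ((Circle.exp (x 1 - x 0) : Circle) : ℂ)) * (1 - ((Circle.exp (x 2 - x 0) : Circle) : ℂ)) * (1 - ((Circle.exp (x 2 - x 1) : Circle) : ℂ))) =
      ((Circle.exp (x 0) : Circle) : ℂ) * (((Circle.exp (x 2) : Circle) : ℂ))⁻¹ *
        ((1 - ((Circle.exp (x 1) : Circle) : ℂ) * (((Circle.exp (x 0) : Circle) : ℂ))⁻¹) * (1 - ((Circle.exp (x 2) : Circle) : ℂ) * (((Circle.exp (x 1) : Circle) : ℂ))⁻¹) *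
          (1 - ((Circle.exp (x 2) : Circle) : ℂ) * (((Circle.exp (x 0) : Circle) : ℂ))⁻¹)) := by
  rw [coe_circleExp_sub, coe_circleExp_sub, coe_circleExp_sub, coe_circleExp_sub]
  ring

/-- **THE NORMALISER IS ALTERNATING UNDER `S₃`**: `N(x ∘ σ) = sign(σ) · N(x)` (★ `rhoWeylDelta_angle_comp_perm`). [cite: Rogawski1990, §8.4 p. 126] [cite: WarnerHASSLG2, §8.4.1] -/
theorem normaliser_comp_perm (σ : Equiv.Perm (Fin 3)) (x : Fin 3 → ℝ) :
    ((Circle.exp ((x ∘ ⇑σ) 0 - (x ∘ ⇑σ) 2) : Circle) : ℂ) *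
        ((1 - ((Circle.exp ((x ∘ ⇑σ) 1 - (x ∘ ⇑σ) 0) : Circle) : ℂ)) * (1 - ((Circle.exp ((x ∘ ⇑σ) 2 - (x ∘ ⇑σ) 0) : Circle) : ℂ)) * (1 - ((Circle.exp ((x ∘ ⇑σ) 2 - (x ∘ ⇑σ) 1) : Circle) : ℂ))) =
      ((Equiv.Perm.sign σ : ℤ) : ℂ) *
        (((Circle.exp (x 0 - x 2) : Circle) : ℂ) * ((1 - ((Circle.exp (x 1 - x 0) : Circle) : ℂ)) * (1 - ((Circle.exp (x 2 - x 0) : Circle) : ℂ)) * (1 - ((Circle.exp (x 2 - x 1) : Circle) : ℂ)))) := by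
  rw [normaliser_eq_rhoWeylDelta, normaliser_eq_rhoWeylDelta]
  exact rhoWeylDelta_angle_comp_perm (fun k => ((Circle.exp (x k) : Circle) : ℂ)) (fun k => Circle.coe_ne_zero _) σ

/-- A triple of reals is injective iff its three pairwise differences are nonzero. [cite: WarnerHASSLG2, §8.4.1] -/
theorem injective_iff_of_fin_three (x : Fin 3 → ℝ) : Function.Injective x ↔ x 0 ≠ x 1 ∧ x 0 ≠ x 2 ∧ x 1 ≠ x 2 := by
  constructor
  · intro h
    exact ⟨fun e => absurd (h e) (by decide), fun e => absurd (h e) (by decide), fun e => absurd (h e) (by decide)⟩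
  · rintro ⟨h01, h02, h12⟩ i j hij
    fin_cases i <;> fin_cases j
    · rfl
    · exact absurd hij h01
    · exact absurd hij h02
    · exact absurd hij.symm h01
    · rfl
    · exact absurd hij h12
    · exact absurd hij.symm h02
    · exact absurd hij.symm h12
    · rfl

/-- **`N = u · π` WITH `u` SMOOTH, `u(0) ≠ 0` AND `u` SYMMETRIC** (`π = rootProduct`; ★ `exists_smooth_rhoWeylDelta_angleChart_eq_mul_rootProduct` at `ζ = 1`; the symmetry of
`u = N ∕ π` — both alternating — holds on the dense regular set and passes to the closure by continuity). [cite: WarnerHASSLG2, §8.4.1] [cite: Rogawski1990, §8.4 p. 126] -/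
theorem exists_smooth_symmetric_unit_normaliser :
    ∃ u : (Fin 3 → ℝ) → ℂ, ContDiff ℝ ∞ u ∧ u 0 ≠ 0 ∧
      (∀ x : Fin 3 → ℝ, ((Circle.exp (x 0 - x 2) : Circle) : ℂ) *
          ((1 - ((Circle.exp (x 1 - x 0) : Circle) : ℂ)) * (1 - ((Circle.exp (x 2 - x 0) : Circle) : ℂ)) * (1 - ((Circle.exp (x 2 - x 1) : Circle) : ℂ))) =
        u x * ((rootProduct x : ℝ) : ℂ)) ∧
      ∀ (σ : Equiv.Perm (Fin 3)) (x : Fin 3 → ℝ), u (x ∘ ⇑σ) = u x := by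
  obtain ⟨u, hu, hu0, hfac⟩ := exists_smooth_rhoWeylDelta_angleChart_eq_mul_rootProduct
  have hN : ∀ x : Fin 3 → ℝ, ((Circle.exp (x 0 - x 2) : Circle) : ℂ) *
      ((1 - ((Circle.exp (x 1 - x 0) : Circle) : ℂ)) * (1 - ((Circle.exp (x 2 - x 0) : Circle) : ℂ)) * (1 - ((Circle.exp (x 2 - x 1) : Circle) : ℂ))) =
        u x * ((rootProduct x : ℝ) : ℂ) := by
    intro x
    have h := hfac 1 x
    simp only [one_mul] at h
    rw [normaliser_eq_rhoWeylDelta]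
    exact h
  refine ⟨u, hu, hu0, hN, ?_⟩
  -- symmetry: on the regular set `u(x∘σ)·sign σ·π(x) = sign σ·u(x)·π(x)`
  intro σ
  have hreg : ∀ x : Fin 3 → ℝ, rootProduct x ≠ 0 → u (x ∘ ⇑σ) = u x := by
    intro x hx
    have h1 := hN (x ∘ ⇑σ)
    rw [normaliser_comp_perm σ x, hN x, rootProduct_comp_perm x σ] at h1
    -- `sign σ * (u x * π x) = u (x∘σ) * (sign σ * π x)`
    have hs : ((Equiv.Perm.sign σ : ℤ) : ℂ) ≠ 0 := by
      rcases Int.units_eq_one_or (Equiv.Perm.sign σ) with h | h <;> simp [h]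
    have hπ : ((rootProduct x : ℝ) : ℂ) ≠ 0 := Complex.ofReal_ne_zero.2 hx
    have h2 : (u (x ∘ ⇑σ) - u x) * (((Equiv.Perm.sign σ : ℤ) : ℂ) * ((rootProduct x : ℝ) : ℂ)) = 0 := by
      push_cast at h1 ⊢
      linear_combination -h1
    rcases mul_eq_zero.1 h2 with h | h
    · exact sub_eq_zero.1 h
    · exact absurd h (mul_ne_zero hs hπ)
  -- density of the regular set and continuity of both sides
  have hdense : Dense {x : Fin 3 → ℝ | rootProduct x ≠ 0} := by
    have heq : {x : Fin 3 → ℝ | rootProduct x ≠ 0} = {x : Fin 3 → ℝ | Function.Injective x} := by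
      ext x
      simp only [Set.mem_setOf_eq, rootProduct_ne_zero_iff, injective_iff_of_fin_three]
    rw [heq]
    exact Literature.Topology.dense_setOf_injective
  have hcomp : Continuous fun x : Fin 3 → ℝ => u (x ∘ ⇑σ) :=
    hu.continuous.comp (continuous_pi fun i => continuous_apply (σ i))
  have h := Continuous.ext_on hdense hcomp hu.continuous fun x hx => hreg x hx
  exact fun x => congrFun h x

end Normaliser

/-! ## §4 Jet bounds of the normalised reading off the noncompact walls near the corner -/

section JetBounds

variable (L : Type) [Field L] [NumberField L] [IsCMField L] (w : {w : InfinitePlace L // IsComplex w})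
  [MeasurableSpace ↥(archLocal L 3 (Matrix.diagonal ![(2 : L)⁻¹, 1, -(2 : L)⁻¹]) w)] [BorelSpace ↥(archLocal L 3 (Matrix.diagonal ![(2 : L)⁻¹, 1, -(2 : L)⁻¹]) w)]
  (νw : Measure ↥(archLocal L 3 (Matrix.diagonal ![(2 : L)⁻¹, 1, -(2 : L)⁻¹]) w)) [νw.IsHaarMeasure] [νw.IsMulRightInvariant]

open scoped Matrix.Norms.Operator

/-- **JET BOUNDS OF THE NORMALISED READING `F = N · R` OFF THE NONCOMPACT WALLS NEAR THE CORNER**: for every order `n` there is `C` with `‖DⁿF(y)‖ ≤ C` at every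
`y ∈ ball 0 (1∕4)` off the two noncompact walls.  On each Weyl chamber this is Harish-Chandra's boundedness of the jets of `π • Φ` (★
`exists_forall_norm_iteratedFDeriv_rootProduct_smul_orbital_le_uniform_centre`) times the smooth unit `u` (`N = u·π`, Leibniz ★ `norm_iteratedFDeriv_mul_le_of_isOpen`); at the
points of the compact wall (off the noncompact ones) `F` is `C^∞` (§2), so the chamber bound passes to them by continuity (the regular set is dense).
[cite: WarnerHASSLG2, Thm. 8.4.3.1; §8.5.1] [cite: Rogawski1990, §8.4 p. 126] [cite: Varadarajan1989, §6.4] -/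
theorem exists_jetBound_normalisedReading_ball {S' : Finset {w : InfinitePlace L // IsComplex w}} (hw : w ∉ S')
    {f : ↥(archLocal L 3 (Matrix.diagonal ![(2 : L)⁻¹, 1, -(2 : L)⁻¹]) w) → ℂ} (fa : Matrix (Fin 3) (Fin 3) ℂ → ℂ) (hfa : ContDiff ℝ ∞ fa)
    (hf : ∀ g, f g = fa ((g : GL (Fin 3) ℂ) : Matrix (Fin 3) (Fin 3) ℂ)) (hfs : HasCompactSupport f) {ζ : Circle} {θζ : ℝ} (hζ : Circle.exp θζ = ζ) (n : ℕ) :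
    ∃ C : ℝ, ∀ y ∈ ball (0 : Fin 3 → ℝ) (1 / 4), y 0 ≠ y 2 → y 1 ≠ y 2 →
      ‖iteratedFDeriv ℝ n (fun x : Fin 3 → ℝ => ((Circle.exp (x 0 - x 2) : Circle) : ℂ) *
          ((1 - ((Circle.exp (x 1 - x 0) : Circle) : ℂ)) * (1 - ((Circle.exp (x 2 - x 0) : Circle) : ℂ)) * (1 - ((Circle.exp (x 2 - x 1) : Circle) : ℂ))) *
            chartOrbGLoc L ![(2 : L)⁻¹, 1, -(2 : L)⁻¹] w S' νw f ((fun _ : Fin 3 => θζ) + x)) y‖ ≤ C := by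
  obtain ⟨u, hu, -, hN, -⟩ := exists_smooth_symmetric_unit_normaliser
  have hfs' : HasCompactSupport fun k : ↥(archLocal L 3 (Matrix.diagonal ![(2 : L)⁻¹, 1, -(2 : L)⁻¹]) w) => fa ((k : GL (Fin 3) ℂ) : Matrix (Fin 3) (Fin 3) ℂ) := by
    have : (fun k : ↥(archLocal L 3 (Matrix.diagonal ![(2 : L)⁻¹, 1, -(2 : L)⁻¹]) w) => fa ((k : GL (Fin 3) ℂ) : Matrix (Fin 3) (Fin 3) ℂ)) = f := (funext hf).symm
    rw [this]; exact hfs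
  -- the orbital integral `Φ` and `F = u · (π • Φ)`
  set Φ : (Fin 3 → ℝ) → ℂ := fun x => ∫ g, fa (((g * ⟨circleDiagonal 3 (fun k => ζ * Circle.exp (x k)),
    circleDiagonal_mem_archLocal_diagonal L 3 ![(2 : L)⁻¹, 1, -(2 : L)⁻¹] w _⟩ * g⁻¹ : ↥(archLocal L 3 (Matrix.diagonal ![(2 : L)⁻¹, 1, -(2 : L)⁻¹]) w)) :
      GL (Fin 3) ℂ) : Matrix (Fin 3) (Fin 3) ℂ) ∂νw with hΦdef
  have hR : ∀ x, chartOrbGLoc L ![(2 : L)⁻¹, 1, -(2 : L)⁻¹] w S' νw f ((fun _ : Fin 3 => θζ) + x) = Φ x :=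
    fun x => chartOrbGLoc_quasiSplitWeights_eq_orbital L w νw hw fa hfa.continuous hf hζ x
  have hF : (fun x : Fin 3 → ℝ => ((Circle.exp (x 0 - x 2) : Circle) : ℂ) *
      ((1 - ((Circle.exp (x 1 - x 0) : Circle) : ℂ)) * (1 - ((Circle.exp (x 2 - x 0) : Circle) : ℂ)) * (1 - ((Circle.exp (x 2 - x 1) : Circle) : ℂ))) *
        chartOrbGLoc L ![(2 : L)⁻¹, 1, -(2 : L)⁻¹] w S' νw f ((fun _ : Fin 3 => θζ) + x)) = fun x => u x * ((rootProduct x : ℝ) • Φ x) := by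
    funext x
    rw [hN x, hR x, Complex.real_smul, mul_assoc]
  rw [hF]
  -- Harish-Chandra's chamber bounds for `π • Φ`, all orders; bounds for `u` on the closed ball
  have hbd : ∀ (σ : Equiv.Perm (Fin 3)) (i : ℕ), ∃ M : ℝ, ∀ y ∈ {θ : Fin 3 → ℝ | θ (σ 0) < θ (σ 1) ∧ θ (σ 1) < θ (σ 2)} ∩ ball (0 : Fin 3 → ℝ) (1 / 4),
      ‖iteratedFDeriv ℝ i (fun x : Fin 3 → ℝ => (rootProduct x : ℝ) • Φ x) y‖ ≤ M := by
    intro σ i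
    obtain ⟨M, hM⟩ := exists_forall_norm_iteratedFDeriv_rootProduct_smul_orbital_le_uniform_centre L ![(2 : L)⁻¹, 1, -(2 : L)⁻¹] w
      (quasiSplitWeights_ne_zero L) (im_embedding_quasiSplitWeights_eq_zero L w) νw fa hfa hfs' σ i
    exact ⟨M, hM ζ⟩
  obtain ⟨A, hA0, hA⟩ := exists_forall_le_norm_iteratedFDeriv_le_of_contDiff hu (1 / 4 : ℝ) n
  -- per chamber: Leibniz
  have hcham : ∀ σ : Equiv.Perm (Fin 3), ∃ Cσ : ℝ, ∀ y ∈ {θ : Fin 3 → ℝ | θ (σ 0) < θ (σ 1) ∧ θ (σ 1) < θ (σ 2)} ∩ ball (0 : Fin 3 → ℝ) (1 / 4),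
      ‖iteratedFDeriv ℝ n (fun x : Fin 3 → ℝ => u x * ((rootProduct x : ℝ) • Φ x)) y‖ ≤ Cσ := by
    intro σ
    obtain ⟨B, -, hB⟩ := exists_forall_le_norm_iteratedFDeriv_le (hbd σ) n
    have hS : IsOpen ({θ : Fin 3 → ℝ | θ (σ 0) < θ (σ 1) ∧ θ (σ 1) < θ (σ 2)} ∩ ball (0 : Fin 3 → ℝ) (1 / 4)) := (isOpen_chamber σ).inter isOpen_ball
    have hg : ContDiffOn ℝ n (fun x : Fin 3 → ℝ => (rootProduct x : ℝ) • Φ x) ({θ : Fin 3 → ℝ | θ (σ 0) < θ (σ 1) ∧ θ (σ 1) < θ (σ 2)} ∩ ball (0 : Fin 3 → ℝ) (1 / 4)) := by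
      have h := contDiffOn_rootProduct_smul_orbital_chamber_ball L ![(2 : L)⁻¹, 1, -(2 : L)⁻¹] w (quasiSplitWeights_ne_zero L)
        (im_embedding_quasiSplitWeights_eq_zero L w) νw fa hfa hfs' ζ σ
      exact (h.of_le (by exact_mod_cast le_top)).mono (Set.inter_subset_inter_right _ (ball_subset_ball (by norm_num)))
    refine ⟨2 ^ n * A * B, norm_iteratedFDeriv_mul_le_of_isOpen hS (hu.contDiffOn.of_le (by exact_mod_cast le_top)) hg hA0
      (fun i hi x hx => hA i hi x (ball_subset_closedBall hx.2)) (fun i hi x hx => hB i hi x hx)⟩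
  choose Cσ hCσ using hcham
  refine ⟨∑ σ, |Cσ σ|, fun y hy h02 h12 => ?_⟩
  -- `F` is `C^∞` on the open set `O` of points of `ball 0 1` off the noncompact walls, which contains `y`
  set O : Set (Fin 3 → ℝ) := ball (0 : Fin 3 → ℝ) 1 ∩ {x : Fin 3 → ℝ | x 0 ≠ x 2 ∧ x 1 ≠ x 2} with hOdef
  have hO : IsOpen O := isOpen_ball.inter ((isOpen_ne_fun (continuous_apply 0) (continuous_apply 2)).inter (isOpen_ne_fun (continuous_apply 1) (continuous_apply 2)))
  have hFO : ContDiffOn ℝ ∞ (fun x : Fin 3 → ℝ => u x * ((rootProduct x : ℝ) • Φ x)) O := by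
    have hRO := contDiffOn_chartOrbGLoc_quasiSplitWeights_ball_offWalls L w νw hw fa hfa hf hfs hζ
    have hΦO : ContDiffOn ℝ ∞ Φ O := hRO.congr fun x _ => (hR x).symm
    exact hu.contDiffOn.mul ((Complex.ofRealCLM.contDiff.comp contDiff_rootProduct).contDiffOn.smul hΦO)
  have hyO : y ∈ O := ⟨ball_subset_ball (by norm_num) hy, h02, h12⟩
  have hcont : ContinuousAt (iteratedFDeriv ℝ n (fun x : Fin 3 → ℝ => u x * ((rootProduct x : ℝ) • Φ x))) y :=
    (continuousOn_iteratedFDeriv_of_isOpen hO hFO n).continuousAt (hO.mem_nhds hyO)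
  -- `y` is a limit of regular points of the small ball, each of which lies in a chamber
  have hycl : y ∈ closure (ball (0 : Fin 3 → ℝ) (1 / 4) ∩ {x : Fin 3 → ℝ | Function.Injective x}) :=
    (Literature.Topology.dense_setOf_injective.open_subset_closure_inter isOpen_ball) hy
  haveI : (𝓝[ball (0 : Fin 3 → ℝ) (1 / 4) ∩ {x : Fin 3 → ℝ | Function.Injective x}] y).NeBot := mem_closure_iff_nhdsWithin_neBot.1 hycl
  have ht : Tendsto (fun z => ‖iteratedFDeriv ℝ n (fun x : Fin 3 → ℝ => u x * ((rootProduct x : ℝ) • Φ x)) z‖)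
      (𝓝[ball (0 : Fin 3 → ℝ) (1 / 4) ∩ {x : Fin 3 → ℝ | Function.Injective x}] y)
      (𝓝 ‖iteratedFDeriv ℝ n (fun x : Fin 3 → ℝ => u x * ((rootProduct x : ℝ) • Φ x)) y‖) :=
    ((continuous_norm.continuousAt.comp hcont).tendsto).mono_left nhdsWithin_le_nhds
  refine le_of_tendsto ht (eventually_of_mem self_mem_nhdsWithin fun z hz => ?_)
  have hz' : z ∈ ⋃ σ : Equiv.Perm (Fin 3), {θ : Fin 3 → ℝ | θ (σ 0) < θ (σ 1) ∧ θ (σ 1) < θ (σ 2)} := by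
    rw [← setOf_injective_eq_iUnion_chamber]; exact hz.2
  obtain ⟨σ, hσ⟩ := mem_iUnion.1 hz'
  exact (hCσ σ z ⟨hσ, hz.1⟩).trans ((le_abs_self _).trans (Finset.single_le_sum (fun τ _ => abs_nonneg (Cσ τ)) (Finset.mem_univ σ)))

end JetBounds

/-! ## §5 The adapted letters of ★ (J) at one place, as bases of `ℝ³` -/

section Letters

/-- **The `w`-component of the adapted letter vectors of ★ `hcAdaptedVec` at the wall `(i, j)`**: normal `e_i − e_j` for the letter `i`, tangential `e_i + e_j`
for the letter `j`, the coordinate vector for the third letter. [cite: Shelstad1979, §4 p. 25] -/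
theorem hcAdaptedVec_self_apply {W : Type*} [DecidableEq W] (w : W) (i j m : Fin 3) :
    hcAdaptedVec w i j (w, m) w =
      if m = i then (Pi.single i 1 : Fin 3 → ℝ) - Pi.single j 1 else if m = j then (Pi.single i 1 : Fin 3 → ℝ) + Pi.single j 1 else Pi.single m 1 := by
  unfold hcAdaptedVec
  simp only [if_true]
  split_ifs <;> simp

/-- **The adapted letters form a basis of `ℝ³`** (`i ≠ j`): `e_i − e_j`, `e_i + e_j`, `e_k`. [cite: Shelstad1979, §4 p. 25] -/
theorem exists_basis_adaptedLetters (i j : Fin 3) (hij : i ≠ j) :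
    ∃ b : Module.Basis (Fin 3) ℝ (Fin 3 → ℝ), ∀ m : Fin 3,
      b m = if m = i then (Pi.single i 1 : Fin 3 → ℝ) - Pi.single j 1 else if m = j then (Pi.single i 1 : Fin 3 → ℝ) + Pi.single j 1 else Pi.single m 1 := by
  set v : Fin 3 → Fin 3 → ℝ := fun m =>
    if m = i then (Pi.single i 1 : Fin 3 → ℝ) - Pi.single j 1 else if m = j then (Pi.single i 1 : Fin 3 → ℝ) + Pi.single j 1 else Pi.single m 1 with hv
  have hli : LinearIndependent ℝ v := by
    rw [Fintype.linearIndependent_iff]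
    intro g hg m
    have h0 := congrFun hg 0
    have h1 := congrFun hg 1
    have h2 := congrFun hg 2
    simp only [hv, Fin.sum_univ_three, Finset.sum_apply, Pi.smul_apply, Pi.zero_apply, smul_eq_mul] at h0 h1 h2
    fin_cases i <;> fin_cases j
    all_goals first
      | exact absurd rfl hij
      | (simp at h0 h1 h2
         fin_cases m <;> simp <;> linarith)
  have hcard : Fintype.card (Fin 3) = Module.finrank ℝ (Fin 3 → ℝ) := by simp
  refine ⟨basisOfLinearIndependentOfCardEqFinrank hli hcard, fun m => ?_⟩
  rw [coe_basisOfLinearIndependentOfCardEqFinrank]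

end Letters




end Literature.NumberTheory.Rogawski1990

end
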